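import Mathlib.Analysis.Complex.LocallyUniformLimit
import Mathlib.Analysis.Complex.Exponential
import Mathlib.Analysis.Normed.Module.MultipliableUniformlyOn
import HarnessLib

/-!
# The structure function of a configuration — auxiliary file 1: the canonical product

Helper file for the stub `stub_structureFunction` of the line `causal-level-sets` for the crux
`WindowTraceArch` (stmt-RiemannHypothesis-11195; skeleton
`Summit.RiemannHypothesis.RiemannHypothesis.Cruxes.WindowTraceArch.CausalLevelSets`; the stub is
proved in `Theorems/SpectralTraceWindowTraceArchStubStructureFunction.lean`).

For a sequence of prospective zeros `w_k` in the lower half-plane (`Im w_k ≤ -δ < 0`,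
`|Im w_k| ≤ B`, `Σ_k 1/(1 + (Re w_k)²) < ∞`; for a configuration `(γ_k, b_k)` of smeared atoms,
`w_k = γ_k - i b_k`) put `a_k = Re (1/w_k)`. The **structure function** is the (modified genus-one)
canonical product
`E(z) = ∏_k (1 - z/w_k) e^{a_k z}`
(the usual genus-one primary factor `(1 - z/w_k)e^{z/w_k}` times the harmless `e^{-i Im(1/w_k) z}`,
which makes `|E|` symmetric under `z ↦ z̄` up to the Blaschke-type quotients `|z - w_k|/|z̄ - w_k|`).
This file proves (no new definitions):

* `structFn_norm_term_le` : `‖(1 - z/w)e^{Re(1/w) z} - 1‖ ≤ (3|z|² + B|z|)/|w|²` for `|z| ≤ |w|`;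
* `structFn_hasProdLocallyUniformlyOn` : the product converges locally uniformly on every disc
  (Weierstrass `M`-test, Mathlib's `Summable.hasProdLocallyUniformlyOn_nat_one_add`), hence
  `structFn_differentiable` : `E` is entire, and `structFn_ne_zero` : `E(z) ≠ 0` for `Im z > -δ`;
* `structFn_logDeriv` (registered sub-goal) : for `Im z > -δ`,
  `E'(z)/E(z) = Σ_k (1/(z - w_k) + a_k)` as a `HasSum` (logarithmic derivatives of the partial
  products and Mathlib's `logDeriv_tendsto` for locally uniform limits).

**Sources.** The genus-one canonical product and its logarithmic derivative are standard
(B. Ya. Levin, *Lectures on Entire Functions* (1996), Lecture 4; L. de Branges, *Hilbert Spaces of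
Entire Functions* (1968), §7). All statements are proved here from Mathlib.
-/

set_option linter.dupNamespace false

noncomputable section

open Complex Set Filter Metric
open scoped Real Topology

namespace Summit.RiemannHypothesis.RiemannHypothesis.Theorems.SpectralTraceWindowTraceArch

/-! ### One factor `(1 - z/w) e^{Re(1/w) z}` -/

/-- **The factors are `1 + O(1/|w|²)`**: `‖(1 - z/w)e^{Re(1/w) z} - 1‖ ≤ (3|z|² + B|z|)/|w|²` for
`|z| ≤ |w|`, `w ≠ 0`, `|Im w| ≤ B` (write the left side as `(e^v - 1 - v) + (v - u) - u(e^v - 1)` with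
`u = z/w`, `v = Re(1/w) z`, `v - u = -i Im(1/w) z`, `|Im(1/w)| = |Im w|/|w|²`). -/
theorem structFn_norm_term_le {B : ℝ} {w : ℂ} (hw0 : w ≠ 0) (hwB : |w.im| ≤ B) {z : ℂ}
    (hz : ‖z‖ ≤ ‖w‖) :
    ‖(1 - z / w) * cexp ((((w⁻¹).re : ℝ) : ℂ) * z) - 1‖ ≤ (3 * ‖z‖ ^ 2 + B * ‖z‖) / ‖w‖ ^ 2 := by
  have hwpos : 0 < ‖w‖ := norm_pos_iff.2 hw0
  set u : ℂ := z / w with hu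
  set v : ℂ := (((w⁻¹).re : ℝ) : ℂ) * z with hv
  have hun : ‖u‖ = ‖z‖ / ‖w‖ := norm_div _ _
  have hvn : ‖v‖ ≤ ‖z‖ / ‖w‖ := by
    rw [hv, norm_mul, Complex.norm_real, div_eq_inv_mul]
    refine mul_le_mul_of_nonneg_right ?_ (norm_nonneg _)
    rw [← norm_inv]
    exact Complex.abs_re_le_norm _
  have hzw : ‖z‖ / ‖w‖ ≤ 1 := div_le_one_of_le₀ hz (norm_nonneg _)
  have hv1 : ‖v‖ ≤ 1 := hvn.trans hzw
  have hcoef : (((w⁻¹).re : ℝ) : ℂ) = w⁻¹ - (((w⁻¹).im : ℝ) : ℂ) * I := by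
    linear_combination Complex.re_add_im (w⁻¹)
  have hvu : v - u = z * (-((((w⁻¹).im : ℝ) : ℂ)) * I) := by
    rw [hv, hu, div_eq_mul_inv, hcoef]
    ring
  have him : |(w⁻¹).im| = |w.im| / ‖w‖ ^ 2 := by
    rw [Complex.inv_im, Complex.sq_norm, neg_div, abs_neg, abs_div,
      abs_of_nonneg (Complex.normSq_nonneg w)]
  have hvun : ‖v - u‖ ≤ B * ‖z‖ / ‖w‖ ^ 2 := by
    rw [hvu, norm_mul, norm_mul, norm_neg, Complex.norm_I, mul_one, Complex.norm_real,
      Real.norm_eq_abs, him]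
    calc ‖z‖ * (|w.im| / ‖w‖ ^ 2) = |w.im| * ‖z‖ / ‖w‖ ^ 2 := by ring
      _ ≤ B * ‖z‖ / ‖w‖ ^ 2 := by gcongr
  have hdec : (1 - z / w) * cexp ((((w⁻¹).re : ℝ) : ℂ) * z) - 1 =
      (cexp v - 1 - v) + (v - u) - u * (cexp v - 1) := by
    rw [hv, hu]
    ring
  have h1 : ‖cexp v - 1 - v‖ ≤ ‖z‖ ^ 2 / ‖w‖ ^ 2 := by
    refine (Complex.norm_exp_sub_one_sub_id_le hv1).trans ?_
    rw [← div_pow]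
    exact pow_le_pow_left₀ (norm_nonneg _) hvn 2
  have h3 : ‖u * (cexp v - 1)‖ ≤ 2 * ‖z‖ ^ 2 / ‖w‖ ^ 2 := by
    rw [norm_mul]
    calc ‖u‖ * ‖cexp v - 1‖ ≤ (‖z‖ / ‖w‖) * (2 * (‖z‖ / ‖w‖)) := by
          rw [hun]
          exact mul_le_mul_of_nonneg_left
            ((Complex.norm_exp_sub_one_le hv1).trans (by linarith)) (by positivity)
      _ = 2 * ‖z‖ ^ 2 / ‖w‖ ^ 2 := by ring
  rw [hdec]
  calc ‖cexp v - 1 - v + (v - u) - u * (cexp v - 1)‖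
      ≤ ‖cexp v - 1 - v‖ + ‖v - u‖ + ‖u * (cexp v - 1)‖ :=
        (norm_sub_le _ _).trans (by gcongr; exact norm_add_le _ _)
    _ ≤ ‖z‖ ^ 2 / ‖w‖ ^ 2 + B * ‖z‖ / ‖w‖ ^ 2 + 2 * ‖z‖ ^ 2 / ‖w‖ ^ 2 := by gcongr
    _ = (3 * ‖z‖ ^ 2 + B * ‖z‖) / ‖w‖ ^ 2 := by ring

/-- `1/|w|² ≤ (1 + δ⁻²)/(1 + (Re w)²)` when `-Im w ≥ δ > 0`. -/
theorem structFn_inv_norm_sq_le {δ : ℝ} (hδ : 0 < δ) {w : ℂ} (hδw : δ ≤ -w.im) :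
    1 / ‖w‖ ^ 2 ≤ (1 + (δ ^ 2)⁻¹) / (1 + w.re ^ 2) := by
  have h2 : δ ^ 2 ≤ w.im ^ 2 := by nlinarith
  have hpos : 0 < ‖w‖ ^ 2 := by
    rw [Complex.sq_norm, Complex.normSq_apply]
    nlinarith [sq_nonneg w.re]
  rw [div_le_div_iff₀ hpos (by positivity), Complex.sq_norm, Complex.normSq_apply]
  have h3 : (δ ^ 2)⁻¹ * δ ^ 2 = 1 := inv_mul_cancel₀ (by positivity)
  nlinarith [mul_le_mul_of_nonneg_left h2 (inv_nonneg.2 (sq_nonneg δ)),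
    mul_nonneg (inv_nonneg.2 (sq_nonneg δ)) (mul_self_nonneg w.re), mul_self_nonneg w.im]

/-- A point of `Im z > -δ` is none of the `w` with `-Im w ≥ δ`. -/
theorem structFn_ne_pt {δ : ℝ} {w : ℂ} (hδw : δ ≤ -w.im) {z : ℂ} (hz : -δ < z.im) : z ≠ w := by
  rintro rfl
  linarith

/-- A factor vanishes only at its zero `w`. -/
theorem structFn_factor_ne_zero {w z : ℂ} (hw0 : w ≠ 0) (hz : z ≠ w) :
    (1 - z / w) * cexp ((((w⁻¹).re : ℝ) : ℂ) * z) ≠ 0 := by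
  refine mul_ne_zero (sub_ne_zero.2 fun h => hz ?_) (Complex.exp_ne_zero _)
  rw [eq_div_iff hw0, one_mul] at h
  exact h.symm

/-- Each factor `(1 - z/w)e^{Re(1/w) z}` is an entire function of `z`. -/
theorem structFn_differentiable_factor (w : ℂ) :
    Differentiable ℂ fun z => (1 - z / w) * cexp ((((w⁻¹).re : ℝ) : ℂ) * z) := by
  fun_prop

/-- Logarithmic derivative of one factor off its zero:
`((1 - z/w)e^{a z})'/((1 - z/w)e^{a z}) = 1/(z - w) + a`, `a = Re(1/w)`. -/
theorem structFn_logDeriv_factor {w z : ℂ} (hw0 : w ≠ 0) (hz : z ≠ w) :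
    logDeriv (fun z => (1 - z / w) * cexp ((((w⁻¹).re : ℝ) : ℂ) * z)) z =
      (z - w)⁻¹ + (((w⁻¹).re : ℝ) : ℂ) := by
  set a : ℂ := (((w⁻¹).re : ℝ) : ℂ) with ha
  have hd : HasDerivAt (fun z => (1 - z / w) * cexp (a * z))
      (-(1 / w) * cexp (a * z) + (1 - z / w) * (cexp (a * z) * (a * 1))) z :=
    (((hasDerivAt_id z).div_const w).const_sub 1).mul ((hasDerivAt_id z).const_mul a).cexp
  rw [logDeriv_apply, hd.deriv]
  have h1 : 1 - z / w ≠ 0 := by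
    refine sub_ne_zero.2 fun h => hz ?_
    rw [eq_div_iff hw0, one_mul] at h
    exact h.symm
  have h2 : z - w ≠ 0 := sub_ne_zero.2 hz
  have h3 : cexp (a * z) ≠ 0 := Complex.exp_ne_zero _
  field_simp
  ring

/-- **Bound on the summands of the logarithmic derivative**:
`‖1/(z - w) + Re(1/w)‖ ≤ |z|/(|z - w| |w|) + B/|w|²` (`|Im w| ≤ B`), from
`1/(z - w) + Re(1/w) = z/((z - w) w) - i Im(1/w)`. -/
theorem structFn_norm_logDerivTerm_le {B : ℝ} {w z : ℂ} (hw0 : w ≠ 0) (hwB : |w.im| ≤ B)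
    (hz : z ≠ w) :
    ‖(z - w)⁻¹ + (((w⁻¹).re : ℝ) : ℂ)‖ ≤ ‖z‖ / (‖z - w‖ * ‖w‖) + B / ‖w‖ ^ 2 := by
  have h2 : z - w ≠ 0 := sub_ne_zero.2 hz
  have hcoef : (((w⁻¹).re : ℝ) : ℂ) = w⁻¹ - (((w⁻¹).im : ℝ) : ℂ) * I := by
    linear_combination Complex.re_add_im (w⁻¹)
  have h3 : (z - w)⁻¹ + w⁻¹ = z / ((z - w) * w) := by
    field_simp
    ring
  have heq : (z - w)⁻¹ + (((w⁻¹).re : ℝ) : ℂ) = z / ((z - w) * w) - (((w⁻¹).im : ℝ) : ℂ) * I := by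
    rw [hcoef]
    linear_combination h3
  have him : |(w⁻¹).im| = |w.im| / ‖w‖ ^ 2 := by
    rw [Complex.inv_im, Complex.sq_norm, neg_div, abs_neg, abs_div,
      abs_of_nonneg (Complex.normSq_nonneg w)]
  rw [heq]
  refine (norm_sub_le _ _).trans (add_le_add ?_ ?_)
  · rw [norm_div, norm_mul]
  · rw [norm_mul, Complex.norm_I, mul_one, Complex.norm_real, Real.norm_eq_abs, him]
    gcongr

/-! ### The sequence of zeros -/

/-- The zeros escape to infinity: `Σ 1/(1 + (Re w_k)²) < ∞` forces `|w_k| ≥ |Re w_k| ≥ R`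
eventually. -/
theorem structFn_eventually_le_norm {w : ℕ → ℂ} (hs : Summable fun k => 1 / (1 + (w k).re ^ 2))
    (R : ℝ) : ∀ᶠ k in atTop, R ≤ ‖w k‖ := by
  have h0 := hs.tendsto_atTop_zero
  have hR : 0 < 1 / (1 + R ^ 2) := by positivity
  filter_upwards [(tendsto_order.1 h0).2 _ hR] with k hk
  have h1 : R ^ 2 < (w k).re ^ 2 := by
    rw [div_lt_div_iff_of_pos_left one_pos (by positivity) (by positivity)] at hk
    linarith
  calc R ≤ |R| := le_abs_self R
    _ ≤ |(w k).re| := (sq_lt_sq.1 h1).le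
    _ ≤ ‖w k‖ := Complex.abs_re_le_norm _

/-- The summable majorant on the disc `|z| ≤ R`: for `|w_k| ≥ R`,
`‖(1 - z/w_k)e^{a_k z} - 1‖ ≤ (3R² + BR)(1 + δ⁻²)/(1 + (Re w_k)²)`. -/
theorem structFn_norm_term_le_of_le {δ B : ℝ} (hδ : 0 < δ) {w : ℂ} (hδw : δ ≤ -w.im)
    (hwB : -w.im ≤ B) {R : ℝ} {z : ℂ} (hzR : ‖z‖ ≤ R) (hR : R ≤ ‖w‖) :
    ‖(1 - z / w) * cexp ((((w⁻¹).re : ℝ) : ℂ) * z) - 1‖ ≤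
      (3 * R ^ 2 + B * R) * ((1 + (δ ^ 2)⁻¹) / (1 + w.re ^ 2)) := by
  have hw0 : w ≠ 0 := by
    rintro rfl
    simp at hδw
    linarith
  have hB : 0 ≤ B := by linarith
  have hR0 : 0 ≤ R := (norm_nonneg _).trans hzR
  have habs : |w.im| ≤ B := by rw [abs_of_nonpos (by linarith)]; exact hwB
  calc ‖(1 - z / w) * cexp ((((w⁻¹).re : ℝ) : ℂ) * z) - 1‖
      ≤ (3 * ‖z‖ ^ 2 + B * ‖z‖) / ‖w‖ ^ 2 := structFn_norm_term_le hw0 habs (hzR.trans hR)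
    _ ≤ (3 * R ^ 2 + B * R) / ‖w‖ ^ 2 := by gcongr
    _ = (3 * R ^ 2 + B * R) * (1 / ‖w‖ ^ 2) := by ring
    _ ≤ (3 * R ^ 2 + B * R) * ((1 + (δ ^ 2)⁻¹) / (1 + w.re ^ 2)) :=
        mul_le_mul_of_nonneg_left (structFn_inv_norm_sq_le hδ hδw) (by positivity)

/-- The majorant is summable. -/
theorem structFn_summable_majorant {w : ℕ → ℂ} (δ : ℝ)
    (hs : Summable fun k => 1 / (1 + (w k).re ^ 2)) (M : ℝ) :
    Summable fun k => M * ((1 + (δ ^ 2)⁻¹) / (1 + (w k).re ^ 2)) := by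
  refine ((hs.mul_left (1 + (δ ^ 2)⁻¹)).mul_left M).congr fun k => ?_
  ring

/-- **Pointwise absolute convergence**: `Σ_k ‖(1 - z/w_k)e^{a_k z} - 1‖ < ∞` for every `z`. -/
theorem structFn_summable_norm_term {w : ℕ → ℂ} {δ B : ℝ} (hδ : 0 < δ)
    (hw : ∀ k, δ ≤ -(w k).im ∧ -(w k).im ≤ B) (hs : Summable fun k => 1 / (1 + (w k).re ^ 2))
    (z : ℂ) : Summable fun k => ‖(1 - z / w k) * cexp (((((w k)⁻¹).re : ℝ) : ℂ) * z) - 1‖ := by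
  refine Summable.of_norm_bounded_eventually_nat
    (structFn_summable_majorant δ hs (3 * ‖z‖ ^ 2 + B * ‖z‖)) ?_
  filter_upwards [structFn_eventually_le_norm hs ‖z‖] with k hk
  rw [norm_norm]
  exact structFn_norm_term_le_of_le hδ (hw k).1 (hw k).2 le_rfl hk

/-! ### The product: locally uniform convergence, entireness, zeros -/

/-- **Locally uniform convergence** of `∏_k (1 - z/w_k)e^{a_k z}` on every disc `|z| < R`. -/
theorem structFn_hasProdLocallyUniformlyOn {w : ℕ → ℂ} {δ B : ℝ} (hδ : 0 < δ)
    (hw : ∀ k, δ ≤ -(w k).im ∧ -(w k).im ≤ B) (hs : Summable fun k => 1 / (1 + (w k).re ^ 2))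
    (R : ℝ) :
    HasProdLocallyUniformlyOn (fun k z => (1 - z / w k) * cexp (((((w k)⁻¹).re : ℝ) : ℂ) * z))
      (fun z => ∏' k, (1 - z / w k) * cexp (((((w k)⁻¹).re : ℝ) : ℂ) * z)) (ball (0 : ℂ) R) := by
  have h := Summable.hasProdLocallyUniformlyOn_nat_one_add
    (f := fun k z => (1 - z / w k) * cexp (((((w k)⁻¹).re : ℝ) : ℂ) * z) - 1)
    (K := ball (0 : ℂ) R) isOpen_ball
    (structFn_summable_majorant δ hs (3 * R ^ 2 + B * R)) ?_
    fun k => ((structFn_differentiable_factor (w k)).sub_const 1).continuous.continuousOn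
  · simpa only [add_sub_cancel] using h
  · filter_upwards [structFn_eventually_le_norm hs R] with k hk z hz
    exact structFn_norm_term_le_of_le hδ (hw k).1 (hw k).2 (mem_ball_zero_iff.1 hz).le hk

/-- The partial products converge locally uniformly on every disc. -/
theorem structFn_tendstoLocallyUniformlyOn {w : ℕ → ℂ} {δ B : ℝ} (hδ : 0 < δ)
    (hw : ∀ k, δ ≤ -(w k).im ∧ -(w k).im ≤ B) (hs : Summable fun k => 1 / (1 + (w k).re ^ 2))
    (R : ℝ) :
    TendstoLocallyUniformlyOn
      (fun N z => ∏ k ∈ Finset.range N, (1 - z / w k) * cexp (((((w k)⁻¹).re : ℝ) : ℂ) * z))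
      (fun z => ∏' k, (1 - z / w k) * cexp (((((w k)⁻¹).re : ℝ) : ℂ) * z)) atTop
      (ball (0 : ℂ) R) :=
  (structFn_hasProdLocallyUniformlyOn hδ hw hs R).tendstoLocallyUniformlyOn_finsetRange

/-- The partial products are entire. -/
theorem structFn_differentiable_prod (w : ℕ → ℂ) (N : ℕ) :
    Differentiable ℂ fun z =>
      ∏ k ∈ Finset.range N, (1 - z / w k) * cexp (((((w k)⁻¹).re : ℝ) : ℂ) * z) :=
  Differentiable.fun_finsetProd fun k _ => structFn_differentiable_factor (w k)

/-- **The structure function is entire.** -/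
theorem structFn_differentiable {w : ℕ → ℂ} {δ B : ℝ} (hδ : 0 < δ)
    (hw : ∀ k, δ ≤ -(w k).im ∧ -(w k).im ≤ B) (hs : Summable fun k => 1 / (1 + (w k).re ^ 2)) :
    Differentiable ℂ fun z => ∏' k, (1 - z / w k) * cexp (((((w k)⁻¹).re : ℝ) : ℂ) * z) := by
  intro z
  have hz : z ∈ ball (0 : ℂ) (‖z‖ + 1) := by simp
  exact ((structFn_tendstoLocallyUniformlyOn hδ hw hs (‖z‖ + 1)).differentiableOn
    (Eventually.of_forall fun N => (structFn_differentiable_prod w N).differentiableOn)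
    isOpen_ball).differentiableAt (isOpen_ball.mem_nhds hz)

/-- The partial products converge pointwise to `E`. -/
theorem structFn_tendsto_prod {w : ℕ → ℂ} {δ B : ℝ} (hδ : 0 < δ)
    (hw : ∀ k, δ ≤ -(w k).im ∧ -(w k).im ≤ B) (hs : Summable fun k => 1 / (1 + (w k).re ^ 2))
    (z : ℂ) :
    Tendsto (fun N => ∏ k ∈ Finset.range N, (1 - z / w k) * cexp (((((w k)⁻¹).re : ℝ) : ℂ) * z))
      atTop (𝓝 (∏' k, (1 - z / w k) * cexp (((((w k)⁻¹).re : ℝ) : ℂ) * z))) := by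
  have h := (multipliable_one_add_of_summable
    (structFn_summable_norm_term hδ hw hs z)).tendsto_prod_tprod_nat
  simpa only [add_sub_cancel] using h

/-- `w_k ≠ 0`. -/
theorem structFn_w_ne_zero {δ : ℝ} (hδ : 0 < δ) {w : ℂ} (hδw : δ ≤ -w.im) : w ≠ 0 := by
  rintro rfl
  simp at hδw
  linarith

/-- **No zeros in `Im z > -δ`.** -/
theorem structFn_ne_zero {w : ℕ → ℂ} {δ B : ℝ} (hδ : 0 < δ)
    (hw : ∀ k, δ ≤ -(w k).im ∧ -(w k).im ≤ B) (hs : Summable fun k => 1 / (1 + (w k).re ^ 2))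
    {z : ℂ} (hz : -δ < z.im) :
    ∏' k, (1 - z / w k) * cexp (((((w k)⁻¹).re : ℝ) : ℂ) * z) ≠ 0 := by
  have h := tprod_one_add_ne_zero_of_summable
    (f := fun k => (1 - z / w k) * cexp (((((w k)⁻¹).re : ℝ) : ℂ) * z) - 1) (fun k => ?_)
    (structFn_summable_norm_term hδ hw hs z)
  · simpa only [add_sub_cancel] using h
  · rw [add_sub_cancel]
    exact structFn_factor_ne_zero (structFn_w_ne_zero hδ (hw k).1) (structFn_ne_pt (hw k).1 hz)

/-! ### The logarithmic derivative -/

/-- Logarithmic derivative of a partial product in `Im z > -δ`. -/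
theorem structFn_logDeriv_prod {w : ℕ → ℂ} {δ B : ℝ} (hδ : 0 < δ)
    (hw : ∀ k, δ ≤ -(w k).im ∧ -(w k).im ≤ B) (N : ℕ) {z : ℂ} (hz : -δ < z.im) :
    logDeriv (fun z => ∏ k ∈ Finset.range N,
        (1 - z / w k) * cexp (((((w k)⁻¹).re : ℝ) : ℂ) * z)) z =
      ∑ k ∈ Finset.range N, ((z - w k)⁻¹ + ((((w k)⁻¹).re : ℝ) : ℂ)) := by
  rw [logDeriv_prod (f := fun k z => (1 - z / w k) * cexp (((((w k)⁻¹).re : ℝ) : ℂ) * z))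
    (s := Finset.range N)
    (fun k _ => structFn_factor_ne_zero (structFn_w_ne_zero hδ (hw k).1)
      (structFn_ne_pt (hw k).1 hz))
    (fun k _ => structFn_differentiable_factor (w k) z)]
  exact Finset.sum_congr rfl fun k _ =>
    structFn_logDeriv_factor (structFn_w_ne_zero hδ (hw k).1) (structFn_ne_pt (hw k).1 hz)

/-- **The logarithmic derivative of the structure function** (registered sub-goal
`structFn_logDeriv`). For `w_k` with `δ ≤ -Im w_k ≤ B` (`δ > 0`), `Σ_k 1/(1 + (Re w_k)²) < ∞`, and
`Im z > -δ`: the series `Σ_k (1/(z - w_k) + Re(1/w_k))` converges (absolutely) to `E'(z)/E(z)`,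
`E(z) = ∏_k (1 - z/w_k) e^{Re(1/w_k) z}`. -/
theorem structFn_logDeriv :
    ∀ (w : ℕ → ℂ) (δ B : ℝ), 0 < δ → (∀ k, δ ≤ -(w k).im ∧ -(w k).im ≤ B) →
      Summable (fun k => 1 / (1 + (w k).re ^ 2)) → ∀ z : ℂ, -δ < z.im →
      HasSum (fun k => (z - w k)⁻¹ + ((((w k)⁻¹).re : ℝ) : ℂ))
        (deriv (fun z => ∏' k, (1 - z / w k) * cexp (((((w k)⁻¹).re : ℝ) : ℂ) * z)) z /
          ∏' k, (1 - z / w k) * cexp (((((w k)⁻¹).re : ℝ) : ℂ) * z)) := by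
  intro w δ B hδ hw hs z hz
  have hw0 : ∀ k, w k ≠ 0 := fun k => structFn_w_ne_zero hδ (hw k).1
  have hB : 0 ≤ B := by linarith [(hw 0).1, (hw 0).2]
  -- absolute convergence
  have hsum : Summable fun k => (z - w k)⁻¹ + ((((w k)⁻¹).re : ℝ) : ℂ) := by
    refine Summable.of_norm_bounded_eventually_nat
      (structFn_summable_majorant δ hs (2 * ‖z‖ + B)) ?_
    filter_upwards [structFn_eventually_le_norm hs (2 * ‖z‖)] with k hk
    have hzk := structFn_ne_pt (hw k).1 hz
    have habs : |(w k).im| ≤ B := by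
      rw [abs_of_nonpos (by linarith [(hw k).1])]
      exact (hw k).2
    have hwpos : 0 < ‖w k‖ := norm_pos_iff.2 (hw0 k)
    have hdist : ‖w k‖ ≤ 2 * ‖z - w k‖ := by
      have := norm_sub_le (w k - z) (-z)
      rw [sub_neg_eq_add, sub_add_cancel, norm_neg, ← norm_neg (w k - z), neg_sub] at this
      linarith
    calc ‖(z - w k)⁻¹ + ((((w k)⁻¹).re : ℝ) : ℂ)‖
        ≤ ‖z‖ / (‖z - w k‖ * ‖w k‖) + B / ‖w k‖ ^ 2 :=
          structFn_norm_logDerivTerm_le (hw0 k) habs hzk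
      _ ≤ ‖z‖ / (‖w k‖ / 2 * ‖w k‖) + B / ‖w k‖ ^ 2 := by
          gcongr
          linarith
      _ = (2 * ‖z‖ + B) * (1 / ‖w k‖ ^ 2) := by
          field_simp
      _ ≤ (2 * ‖z‖ + B) * ((1 + (δ ^ 2)⁻¹) / (1 + (w k).re ^ 2)) :=
          mul_le_mul_of_nonneg_left (structFn_inv_norm_sq_le hδ (hw k).1) (by positivity)
  -- the partial sums are the logarithmic derivatives of the partial products
  have hzb : z ∈ ball (0 : ℂ) (‖z‖ + 1) := by simp
  have ht : Tendsto (fun N => ∑ k ∈ Finset.range N, ((z - w k)⁻¹ + ((((w k)⁻¹).re : ℝ) : ℂ)))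
      atTop (𝓝 (logDeriv
        (fun z => ∏' k, (1 - z / w k) * cexp (((((w k)⁻¹).re : ℝ) : ℂ) * z)) z)) := by
    have h := logDeriv_tendsto isOpen_ball hzb (structFn_tendstoLocallyUniformlyOn hδ hw hs _)
      (Eventually.of_forall fun N => (structFn_differentiable_prod w N).differentiableOn)
      (structFn_ne_zero hδ hw hs hz)
    exact h.congr fun N => structFn_logDeriv_prod hδ hw N hz
  have hu := tendsto_nhds_unique hsum.hasSum.tendsto_sum_nat ht
  rw [logDeriv_apply] at hu
  rw [← hu]
  exact hsum.hasSum

end Summit.RiemannHypothesis.RiemannHypothesis.Theorems.SpectralTraceWindowTraceArch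

end
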